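import Mathlib
import HarnessLib
import Summits.HubbardSuperconductivity.HubbardSuperconductivity.Theorems.ChiralWindowCwKLChiralWindowNodeBoundX
import Summits.HubbardSuperconductivity.HubbardSuperconductivity.Theorems.ChiralWindowCwKLChiralWindowBlockNodeS
import Summits.HubbardSuperconductivity.HubbardSuperconductivity.Theorems.ChiralWindowCwKLChiralWindowBlockBoundsXTrig

/-!
# Crux `CwKLChiralWindow` (stmt-1741), line `Sketch`: block-level node data, `E_x`-BLOCK form (F4b-X)

`stub_klBlockNodeX`: the `E_x`-block variant of `…BlockNodeS` (`stub_klBlockNodeS`).  Same records (`KLBlock`,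
vocabulary of `Theorems/ChiralWindowDefs.lean` read in the residual form of `…DefsResidual.lean` with the sector row
bounds of `…DefsSector.lean`), same enclosures `b.EnclosureR tab μ χ`, but the Temple test is the `E_x`-form one
`b.templeOKX tab χ` of `Theorems/ChiralWindowDefsEx.lean` and the certified lower bound is `b.lowerX tab χ`.  Off the
doublet channel nothing changes (`templeOKX = templeOKR`, `lowerX = lowerR`, multiplicity condition `Hhi < 2ρhi²`) and
the statement is `stub_klBlockNodeS` verbatim.  On `χ = E` the test asks for a COSINE-ONLY trial (reflection-even, an
`E_x` function) and a QUARTER-TURN-PAIRED deflation list (`KLBlock.deflPairsOK`: consecutive pairs `(c,u), (c, rot1 u)`),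
under which the certificate runs on the reflection-even block `E_x = {P v = v, S v = v}` of the `E` sector, where the
bottom is simple and the deflated square mass is `Hhi/2`: level condition `Hhi/2 - ρhi² ≤ β²`, simplicity condition
`Hhi < 4ρhi²` — the abstract bound is `stub_klNodeBoundX` (`…NodeBoundX`).  Conclusion, for every bottom state `ψ` of
the channel, a.e. on the Fermi curve: `|F_Φ(k)| ≤ √N (|L| |ψ(k)| + √R2 √e)` off `E` and
`|F_Φ(k)|, |F_Φ(rot³k)| ≤ √N (|L| √(ψ(k)² + ψ(rot k)²) + √R2 √e)` on `E` (`Φ = b.trialFun tab`, `F_Φ = ∫ χ₀ Φ`,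
`N = ∫Φ²`, `L = b.lowerX tab χ`, `e = b.katoR`, `R2` a row bound of the SECTOR kernel `b.sectorKernel μ χ`).

Proof.  `χ ≠ E`: rewrite `templeOKX`/`lowerX` to the residual forms (`klX_templeOKX_of_ne`, `kl_bknx_lowerX_of_ne`)
and apply `stub_klBlockNodeS`.  `χ = E`: instantiate `stub_klNodeBoundX` with the block's data exactly as `…BlockNodeS`
does (Rayleigh bookkeeping `kl_bkn_rayleigh` with the residual integral, deflation family `kl_bkn_deflKernel_eq`, base
kernel plain `χ₀` since `withU = false`, sector row bound via `klS_sectorKernel_eq`, translations of `lowerX`/`katoR` by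
`push_cast`), supplying its two symmetry hypotheses from the Boolean test by the lemmas of `…BlockBoundsXTrig`: the
cosine-only trial is reflection-even (`kl_bkbx_trialFun_refl`) and the paired deflation kernel of `E`-pattern (odd)
vectors is quarter-turn invariant (`kl_bkbx_deflKernel_rot`).
-/

noncomputable section

set_option linter.dupNamespace false

namespace Summit.HubbardSuperconductivity.HubbardSuperconductivity.Theorems

open MeasureTheory Literature.MathematicalPhysics.QuantumLattice CwKLChiralWindow

/-- Off the doublet channel the `E_x`-form lower bound is the residual-form one. [folklore] -/
theorem kl_bknx_lowerX_of_ne (b : KLBlock) (tab : List KLTrig) {χ : D4Irrep} (h : χ ≠ D4Irrep.E) :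
    b.lowerX tab χ = b.lowerR tab χ := by
  simp only [KLBlock.lowerX, KLBlock.lowerR, klX_templeOKX_of_ne b tab χ h]

/-- **Block-level node data, `E_x`-block form (F4b-X).** For `μ ∈ (-4,0)`, a block `b` with `E_x`-form Temple data
(`b.templeOKX tab χ`) in a channel `χ ≠ A1g` without the bare-`U` term, the residual-form block enclosures, a row bound
`R2` for the SECTOR kernel `b.sectorKernel μ χ` and the multiplicity condition `Hhi < 2ρhi²` (`Hhi < 4ρhi²` on `E`:
simplicity of the `E_x` bottom): every bottom state `ψ` of the channel obeys, a.e. on the Fermi curve,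
`|F_Φ(k)| ≤ √N (|L| |ψ(k)| + √R2 √e)` off `E` and `|F_Φ(k)|, |F_Φ(rot³k)| ≤ √N (|L| √(ψ(k)² + ψ(rot k)²) + √R2 √e)` on
`E` (`Φ` the block's trial, `F_Φ = ∫ χ₀ Φ`, `N = ∫Φ²`, `L = b.lowerX tab χ`, `e = b.katoR`). [folklore] -/
theorem stub_klBlockNodeX : ∀ μ ∈ Set.Ioo (-4 : ℝ) 0, ∀ (b : KLBlock) (tab : List KLTrig) (χ : D4Irrep) (R2 : ℝ),
    b.templeOKX tab χ = true → b.withU = false → χ ≠ D4Irrep.A1g → b.EnclosureR tab μ χ → 0 ≤ R2 →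
    (∀ᵐ k ∂fermiCurveMeasure (squareDispersion 1 0) μ,
      ∫ k', b.sectorKernel μ χ k k' ^ 2 ∂fermiCurveMeasure (squareDispersion 1 0) μ ≤ R2) →
    (b.Hhi : ℝ) < (if χ = D4Irrep.E then 4 else 2) * (b.rhohi : ℝ) ^ 2 →
    ∀ ψ : Momentum → ℝ, IsChannelState (squareDispersion 1 0) μ χ ψ →
      pairingForm (squareDispersion 1 0) μ 1 ψ = channelInf (squareDispersion 1 0) μ 1 χ →
      (χ ≠ D4Irrep.E → ∀ᵐ k ∂fermiCurveMeasure (squareDispersion 1 0) μ,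
        |∫ k', lindhardFunction (squareDispersion 1 0) μ (k + k') * b.trialFun tab k'
            ∂fermiCurveMeasure (squareDispersion 1 0) μ| ≤
          Real.sqrt (∫ k, b.trialFun tab k ^ 2 ∂fermiCurveMeasure (squareDispersion 1 0) μ) *
            (|((b.lowerX tab χ : ℚ) : ℝ)| * |ψ k| + Real.sqrt R2 * Real.sqrt ((b.katoR : ℚ) : ℝ))) ∧
      (χ = D4Irrep.E → ∀ᵐ k ∂fermiCurveMeasure (squareDispersion 1 0) μ,
        |∫ k', lindhardFunction (squareDispersion 1 0) μ (k + k') * b.trialFun tab k'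
            ∂fermiCurveMeasure (squareDispersion 1 0) μ| ≤
          Real.sqrt (∫ k, b.trialFun tab k ^ 2 ∂fermiCurveMeasure (squareDispersion 1 0) μ) *
            (|((b.lowerX tab χ : ℚ) : ℝ)| * Real.sqrt (ψ k ^ 2 + ψ (rotMomentum k) ^ 2) +
              Real.sqrt R2 * Real.sqrt ((b.katoR : ℚ) : ℝ)) ∧
        |∫ k', lindhardFunction (squareDispersion 1 0) μ (rotMomentum (rotMomentum (rotMomentum k)) + k') *
            b.trialFun tab k' ∂fermiCurveMeasure (squareDispersion 1 0) μ| ≤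
          Real.sqrt (∫ k, b.trialFun tab k ^ 2 ∂fermiCurveMeasure (squareDispersion 1 0) μ) *
            (|((b.lowerX tab χ : ℚ) : ℝ)| * Real.sqrt (ψ k ^ 2 + ψ (rotMomentum k) ^ 2) +
              Real.sqrt R2 * Real.sqrt ((b.katoR : ℚ) : ℝ))) := by
  intro μ hμ b tab χ R2 hT hWU hχA hE hR2 hR hmul ψ hψs hbot
  by_cases hχE : χ = D4Irrep.E
  · -- the doublet channel: the `E_x`-block node bound `stub_klNodeBoundX`
    subst hχE
    refine ⟨fun h => absurd rfl h, fun _ => ?_⟩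
    -- the Boolean test, unpacked
    have hT' := hT
    simp only [KLBlock.templeOKX, ↓reduceIte, KLBlock.ritzOK, KLBlock.deflOK, Bool.and_eq_true,
      decide_eq_true_eq, List.all_eq_true, Bool.or_eq_true, Bool.not_eq_true'] at hT'
    obtain ⟨⟨⟨⟨⟨⟨⟨⟨⟨⟨⟨⟨⟨⟨huse, -⟩, hfits⟩, hNlo⟩, -⟩, -⟩, hQhi⟩, -⟩, hdefl⟩, hpairs⟩, hcos⟩, hThi⟩, hβ0⟩,
      hHβ⟩, hρβ⟩ := hT'
    -- the enclosures, unpacked (the base kernel is plain `χ₀`: `withU = false`)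
    obtain ⟨h1, hH⟩ := hE
    obtain ⟨hN1, hN2, hQ1, hQ2, hEE⟩ := h1 huse
    simp only [KLBlock.baseKernel, hWU, Bool.false_eq_true, ↓reduceIte, zero_add] at hQ1 hQ2 hEE
    simp only [klS_sectorKernel_eq b μ _ _ _ hWU, kl_bkn_deflKernel_eq] at hH
    -- the Rayleigh bookkeeping, with `T :=` the residual integral
    obtain ⟨hN, hρlo, hρhi, hρhi0, het⟩ := kl_bkn_rayleigh (by exact_mod_cast hNlo) hN1 hN2 hQ1 hQ2
      (by exact_mod_cast hQhi) hEE (by exact_mod_cast hThi)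
    have hρlo_eq : ((b.rholo : ℚ) : ℝ) = min ((b.Qlo : ℝ) / b.Nlo) ((b.Qlo : ℝ) / b.Nhi) := by
      rw [KLBlock.rholo]; push_cast; rfl
    have hρhi_eq : ((b.rhohi : ℚ) : ℝ) = max ((b.Qhi : ℝ) / b.Nlo) ((b.Qhi : ℝ) / b.Nhi) := by
      rw [KLBlock.rhohi]; push_cast; rfl
    have het_eq : ((b.etil : ℚ) : ℝ) = (b.Thi : ℝ) / b.Nlo := by
      rw [KLBlock.etil]; push_cast; rfl
    rw [← hρlo_eq] at hρlo
    rw [← hρhi_eq] at hρhi hρhi0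
    rw [← het_eq] at het
    have hHβ' : (b.Hhi : ℝ) / 2 - (b.rhohi : ℝ) ^ 2 ≤ (b.beta : ℝ) ^ 2 := by exact_mod_cast hHβ
    have hmul' : (b.Hhi : ℝ) < 4 * (b.rhohi : ℝ) ^ 2 := by simpa using hmul
    -- the sector row bound, read as the row bound of `d4Project E (χ₀ row)`
    have hR' : ∀ᵐ k ∂fermiCurveMeasure (squareDispersion 1 0) μ, ∫ k', (d4Project D4Irrep.E (fun q =>
        lindhardFunction (squareDispersion 1 0) μ (k + q)) k') ^ 2 ∂fermiCurveMeasure (squareDispersion 1 0) μ ≤ R2 := by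
      simpa only [klS_sectorKernel_eq b μ _ _ _ hWU] using hR
    -- the translations of `lowerX` and `katoR`
    have hlower : ((b.lowerX tab D4Irrep.E : ℚ) : ℝ) =
        min (((b.beta : ℝ) * b.rholo - b.rholo ^ 2 - b.etil) / (b.beta - b.rholo))
          (((b.beta : ℝ) * b.rhohi - b.rhohi ^ 2 - b.etil) / (b.beta - b.rhohi)) := by
      rw [KLBlock.lowerX, if_pos (by rw [huse, hT, Bool.true_and])]
      simp only [KLBlock.templeR]; push_cast; rfl
    have hkato : ((b.katoR : ℚ) : ℝ) = (b.etil : ℝ) / (b.beta - b.rhohi) ^ 2 := by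
      rw [KLBlock.katoR]; push_cast; rfl
    -- the two symmetries of the `E_x` block: reflection-even trial, quarter-turn invariant deflation
    -- (`…BlockBoundsXTrig`: `kl_bkbx_trialFun_refl`, `kl_bkbx_deflKernel_rot`)
    have hD : b.deflOK tab D4Irrep.E = true := by
      simp only [KLBlock.deflOK, List.all_eq_true, Bool.and_eq_true, decide_eq_true_eq]; exact hdefl
    have hrot := kl_bkbx_deflKernel_rot b tab hpairs hD
    -- the abstract node bound, instantiated with the block's data
    have hnb := stub_klNodeBoundX μ hμ b.defl.length (fun m => ((b.defl[m.1]).1 : ℝ))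
      (fun m => (klTab tab (b.defl[m.1]).2).toFun) (b.trialFun tab) b.rholo b.rhohi b.etil b.Hhi b.beta b.s R2
      (fun m => Rat.cast_nonneg.2 (hdefl _ (List.getElem_mem m.2)).1.1)
      (fun m => kl_tr_toFun_memLp _ hμ) (kl_tr_toFun_memLp _ hμ) (stub_klTrigChannel _ _ hfits)
      (kl_bkbx_trialFun_refl b tab hcos) hrot hN hρlo hρhi hρhi0 het hH (by exact_mod_cast hβ0) hHβ'
      (by exact_mod_cast hρβ) hR2 hR' hmul' ψ hψs hbot
    rw [hlower, hkato]
    exact hnb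
  · -- off the doublet channel: the residual-form block node data `stub_klBlockNodeS` verbatim
    rw [klX_templeOKX_of_ne b tab χ hχE] at hT
    have hmul' : (b.Hhi : ℝ) < (if χ = D4Irrep.E then 3 else 2) * (b.rhohi : ℝ) ^ 2 := by
      rw [if_neg hχE] at hmul ⊢; exact hmul
    rw [kl_bknx_lowerX_of_ne b tab hχE]
    exact stub_klBlockNodeS μ hμ b tab χ R2 hT hWU hχA hE hR2 hR hmul' ψ hψs hbot

end Summit.HubbardSuperconductivity.HubbardSuperconductivity.Theorems

end
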